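import Literature.Computability.AlgebraicComplexity.FermionantCompletenessProofs
import HarnessLib

/-!
# Route `FermionicJet`, crux `QuadraticDcCdet` (stmt-ValiantsHypothesis-5343) — helper 1:
# signed cycle-count sums over permutations with prescribed values

Bookkeeping for the coefficient function `σ ↦ sgn σ · c(σ)` of the cycle-counting determinant
`cdetPoly = Σ_σ sgn σ · c(σ) · ∏ X_{σ i, i}` (`c` = `Equiv.Perm.numCycles`, `FermionicPencil.lean`),
built on `numCycles_optionCongr` / `numCycles_swap_mul_optionCongr` of
`FermionantCompletenessProofs.lean`.  These sums are the second partial derivatives of `cdet_n`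
at matrices all of whose entries but one coincide, i.e. the entries of the Hessian used for the
Mignon–Ressayre bound `n² ≤ 2·dc(cdet_n)` (crux `QuadraticDcCdet`):

* `ofSubtype` (extension by a fixed point) raises `numCycles` by one; inserting a point into a
  cycle (`swap a b * ofSubtype τ`) keeps `numCycles` and flips the sign
  (`numCycles_ofSubtype_ne`, `numCycles_swap_mul_ofSubtype`, `sign_swap_mul_ofSubtype`);
* the corresponding reindexing of the sums over `{π | π b = b}` and `{π | π b = a}` by
  permutations of `{y // y ≠ b}` (`sum_perm_apply_eq_self`, `sum_perm_apply_eq_swap_mul`);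
* the totals `Σ_π sgn π` (`= 1` if `card ≤ 1`, else `0`; `sum_sign_eq`) and `Σ_π sgn π · c(π)`
  (`= (-1)^m · (m-2)!` on `m ≥ 2` points, `= m` on `m ≤ 1` points; `sum_sign_mul_numCycles_eq`):
  the `u`-derivative at `u = 1` of the falling factorial `Σ_π sgn π · u^{c(π)} = u(u-1)⋯(u-m+1)`
  (signed Stirling numbers of the first kind; R. P. Stanley, *Enumerative Combinatorics* I,
  2nd ed., Prop. 1.3.7);
* one prescribed value: `Σ_{π b = a} sgn π` and `Σ_{π b = a} sgn π · c(π)`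
  (`sum_sign_apply_eq`, `sum_sign_mul_numCycles_apply_eq`).

HONEST FRAMING: elementary permutation combinatorics serving a dormant route's crux; nothing here
bears on `VP ≠ VNP`, which is NOT proved.
-/

noncomputable section

open Equiv Equiv.Perm Finset

-- layout Summits/ValiantsHypothesis/ValiantsHypothesis forces the duplicated namespace component
set_option linter.dupNamespace false

namespace Summit.ValiantsHypothesis.ValiantsHypothesis.Theorems.FermionicJet.NumCyclesSums

universe u

variable {β : Type u} [Fintype β] [DecidableEq β]

/-! ### Extension by a fixed point and insertion into a cycle -/

omit [Fintype β] in
/-- Extension of a permutation of `{y // y ≠ b}` by the fixed point `b` is conjugate, along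
`Equiv.optionSubtypeNe b`, to `optionCongr`. [folklore] -/
theorem ofSubtype_eq_permCongr_optionCongr (b : β) (τ : Perm {y // y ≠ b}) :
    (ofSubtype τ : Perm β) = (optionSubtypeNe b).permCongr τ.optionCongr := by
  ext y
  by_cases hy : y = b
  · subst hy
    rw [ofSubtype_apply_of_not_mem τ (not_ne_iff.mpr rfl), Equiv.permCongr_apply,
      optionSubtypeNe_symm_self]
    simp
  · rw [ofSubtype_apply_of_mem τ hy, Equiv.permCongr_apply, optionSubtypeNe_symm_of_ne hy]
    simp

/-- Extending by a fixed point adds one cycle: `c(ofSubtype τ) = c(τ) + 1`. [folklore] -/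
theorem numCycles_ofSubtype_ne (b : β) (τ : Perm {y // y ≠ b}) :
    (ofSubtype τ : Perm β).numCycles = τ.numCycles + 1 := by
  rw [ofSubtype_eq_permCongr_optionCongr, Literature.Computability.AlgebraicComplexity.DeRugyAltherre.numCycles_permCongr,
    Literature.Computability.AlgebraicComplexity.DeRugyAltherre.numCycles_optionCongr]

omit [Fintype β] in
/-- Inserting the point `b` into a cycle just before `a`: `swap a b * ofSubtype τ` is conjugate,
along `Equiv.optionSubtypeNe b`, to `swap none (some a) * optionCongr τ`. [folklore] -/
theorem swap_mul_ofSubtype_eq_permCongr {a b : β} (hab : a ≠ b) (τ : Perm {y // y ≠ b}) :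
    swap a b * (ofSubtype τ : Perm β) =
      (optionSubtypeNe b).permCongr (swap none (some ⟨a, hab⟩) * τ.optionCongr) := by
  ext y
  rw [Perm.mul_apply, Equiv.permCongr_apply, Perm.mul_apply]
  by_cases hy : y = b
  · subst hy
    rw [ofSubtype_apply_of_not_mem τ (not_ne_iff.mpr rfl), swap_apply_right,
      optionSubtypeNe_symm_self]
    simp
  · rw [ofSubtype_apply_of_mem τ hy, optionSubtypeNe_symm_of_ne hy]
    simp only [optionCongr_apply, Option.map_some]
    by_cases hτ : τ ⟨y, hy⟩ = ⟨a, hab⟩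
    · rw [hτ, swap_apply_right]
      simp [swap_apply_left]
    · have hτ' : ((τ ⟨y, hy⟩ : {y // y ≠ b}) : β) ≠ a := fun h => hτ (Subtype.ext h)
      rw [swap_apply_of_ne_of_ne hτ' (τ ⟨y, hy⟩).2,
        swap_apply_of_ne_of_ne (Option.some_ne_none _) (fun h => hτ (Option.some_injective _ h))]
      simp

/-- Inserting a point into a cycle keeps the number of cycles:
`c(swap a b * ofSubtype τ) = c(τ)` for `a ≠ b`, `τ ∈ Perm {y // y ≠ b}`. [folklore] -/
theorem numCycles_swap_mul_ofSubtype {a b : β} (hab : a ≠ b) (τ : Perm {y // y ≠ b}) :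
    (swap a b * (ofSubtype τ : Perm β)).numCycles = τ.numCycles := by
  rw [swap_mul_ofSubtype_eq_permCongr hab, Literature.Computability.AlgebraicComplexity.DeRugyAltherre.numCycles_permCongr,
    Literature.Computability.AlgebraicComplexity.DeRugyAltherre.numCycles_swap_mul_optionCongr]

/-- `sgn (ofSubtype τ) = sgn τ`, integer form. [folklore] -/
theorem sign_ofSubtype_int {b : β} (τ : Perm {y // y ≠ b}) :
    (Perm.sign (ofSubtype τ : Perm β) : ℤ) = (Perm.sign τ : ℤ) := by
  rw [Perm.sign_ofSubtype]

/-- `sgn (swap a b * ofSubtype τ) = - sgn τ` for `a ≠ b`. [folklore] -/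
theorem sign_swap_mul_ofSubtype {a b : β} (hab : a ≠ b) (τ : Perm {y // y ≠ b}) :
    (Perm.sign (swap a b * (ofSubtype τ : Perm β)) : ℤ) = -(Perm.sign τ : ℤ) := by
  rw [Perm.sign_mul, Perm.sign_swap hab, Perm.sign_ofSubtype, Units.val_mul, Units.val_neg,
    Units.val_one, neg_one_mul]

omit [Fintype β] in
/-- Values of the inserted permutation away from `b`:
`(swap a b * ofSubtype τ) y = b` if `τ y = a`, and `= τ y` otherwise. [folklore] -/
theorem swap_mul_ofSubtype_apply_of_ne (a : β) {b : β} (τ : Perm {y // y ≠ b}) {y : β}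
    (hy : y ≠ b) :
    (swap a b * (ofSubtype τ : Perm β)) y =
      if ((τ ⟨y, hy⟩ : {y // y ≠ b}) : β) = a then b else (τ ⟨y, hy⟩ : β) := by
  rw [Perm.mul_apply, ofSubtype_apply_of_mem τ hy]
  by_cases h : ((τ ⟨y, hy⟩ : {y // y ≠ b}) : β) = a
  · rw [if_pos h, h, swap_apply_left]
  · rw [if_neg h, swap_apply_of_ne_of_ne h (τ ⟨y, hy⟩).2]

omit [Fintype β] in
/-- The inserted permutation sends `b` to `a`. [folklore] -/
theorem swap_mul_ofSubtype_apply_self (a b : β) (τ : Perm {y // y ≠ b}) :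
    (swap a b * (ofSubtype τ : Perm β)) b = a := by
  rw [Perm.mul_apply, ofSubtype_apply_of_not_mem τ (not_ne_iff.mpr rfl), swap_apply_right]

omit [Fintype β] in
/-- Values of the extended permutation away from `b`. [folklore] -/
theorem ofSubtype_apply_of_ne' {b : β} (τ : Perm {y // y ≠ b}) {y : β} (hy : y ≠ b) :
    (ofSubtype τ : Perm β) y = (τ ⟨y, hy⟩ : β) :=
  ofSubtype_apply_of_mem τ hy

/-! ### Reindexing sums over permutations with one prescribed value -/

variable {M : Type*} [AddCommMonoid M]

/-- `Σ_{π : π b = b} F π = Σ_{τ ∈ Perm {y ≠ b}} F (ofSubtype τ)`. [folklore] -/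
theorem sum_perm_apply_eq_self (b : β) (F : Perm β → M) :
    (∑ π : Perm β, if π b = b then F π else 0) = ∑ τ : Perm {y // y ≠ b}, F (ofSubtype τ) := by
  rw [← Finset.sum_filter, Finset.sum_subtype (p := fun π : Perm β => π b = b)
    (Finset.univ.filter fun π : Perm β => π b = b) (fun π => by simp)]
  let e : Perm {y // y ≠ b} ≃ {π : Perm β // π b = b} :=
    (Equiv.Perm.subtypeEquivSubtypePerm fun y => y ≠ b).trans
      (Equiv.subtypeEquivRight fun π => by simp only [ne_eq, not_not, forall_eq])
  exact (Fintype.sum_equiv e _ _ fun τ => rfl).symm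

/-- `Σ_{π : π b = a} F π = Σ_{τ ∈ Perm {y ≠ b}} F (swap a b * ofSubtype τ)` (meant for `a ≠ b`;
for `a = b` it degenerates correctly since `swap b b = 1`). [folklore] -/
theorem sum_perm_apply_eq_swap_mul (a b : β) (F : Perm β → M) :
    (∑ π : Perm β, if π b = a then F π else 0) =
      ∑ τ : Perm {y // y ≠ b}, F (swap a b * ofSubtype τ) := by
  rw [← Finset.sum_filter, Finset.sum_subtype (p := fun π : Perm β => π b = a)
    (Finset.univ.filter fun π : Perm β => π b = a) (fun π => by simp)]
  let e₁ : Perm {y // y ≠ b} ≃ {π : Perm β // π b = b} :=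
    (Equiv.Perm.subtypeEquivSubtypePerm fun y => y ≠ b).trans
      (Equiv.subtypeEquivRight fun π => by simp only [ne_eq, not_not, forall_eq])
  let e : Perm {y // y ≠ b} ≃ {π : Perm β // π b = a} :=
    e₁.trans (Equiv.subtypeEquiv (Equiv.mulLeft (swap a b)) fun π => by
      simp only [Equiv.coe_mulLeft, Perm.mul_apply]
      constructor
      · intro h; rw [h, swap_apply_right]
      · intro h
        have h2 : swap a b (swap a b (π b)) = swap a b a := by rw [h]
        rwa [swap_apply_self, swap_apply_left] at h2)
  exact (Fintype.sum_equiv e _ _ fun τ => rfl).symm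

/-- Splitting a sum over permutations according to the image of a point. [folklore] -/
theorem sum_perm_eq_sum_sum_ite (b : β) (F : Perm β → M) :
    ∑ π : Perm β, F π = ∑ a : β, ∑ π : Perm β, if π b = a then F π else 0 := by
  rw [Finset.sum_comm]
  refine Finset.sum_congr rfl fun π _ => ?_
  rw [Finset.sum_ite_eq Finset.univ (π b) (fun _ => F π), if_pos (Finset.mem_univ _)]

/-! ### The totals `Σ sgn` and `Σ sgn · c` -/

/-- Cardinality of `{y // y ≠ b}`. [folklore] -/
theorem card_subtype_ne (b : β) : Fintype.card {y // y ≠ b} = Fintype.card β - 1 := by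
  rw [Fintype.card_subtype_compl, Fintype.card_subtype_eq]

variable {R : Type*} [CommRing R]

/-- One step of the recursion for `Σ_π sgn π`: `Σ_π sgn π = (2 - card β) · Σ_τ sgn τ`, the
inner sum over permutations of `{y // y ≠ b}`. [folklore] -/
theorem sum_sign_step (b : β) :
    (∑ π : Perm β, ((Perm.sign π : ℤ) : R)) =
      (2 - (Fintype.card β : R)) * ∑ τ : Perm {y // y ≠ b}, ((Perm.sign τ : ℤ) : R) := by
  rw [sum_perm_eq_sum_sum_ite b]
  have hterm : ∀ a : β, (∑ π : Perm β, if π b = a then ((Perm.sign π : ℤ) : R) else 0) =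
      (if a = b then (1 : R) else -1) * ∑ τ : Perm {y // y ≠ b}, ((Perm.sign τ : ℤ) : R) := by
    intro a
    by_cases hab : a = b
    · rw [hab, sum_perm_apply_eq_self, if_pos rfl, one_mul]
      exact Finset.sum_congr rfl fun τ _ => by rw [sign_ofSubtype_int]
    · rw [sum_perm_apply_eq_swap_mul a b, if_neg hab, Finset.mul_sum]
      exact Finset.sum_congr rfl fun τ _ => by rw [sign_swap_mul_ofSubtype hab]; push_cast; ring
  simp_rw [hterm]
  rw [← Finset.sum_mul, Finset.sum_ite, Finset.sum_const, Finset.sum_const,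
    Finset.filter_eq' Finset.univ b, if_pos (Finset.mem_univ b), Finset.card_singleton,
    Finset.filter_ne' Finset.univ b, Finset.card_erase_of_mem (Finset.mem_univ b),
    Finset.card_univ]
  have h1 : 1 ≤ Fintype.card β := Fintype.card_pos_iff.mpr ⟨b⟩
  simp only [nsmul_eq_mul, Nat.cast_sub h1, Nat.cast_one, one_smul, smul_neg]
  ring

/-- One step of the recursion for `Σ_π sgn π · c(π)`:
`Σ_π sgn π · c(π) = (2 - card β) · Σ_τ sgn τ · c(τ) + Σ_τ sgn τ`, inner sums over permutations of
`{y // y ≠ b}` (the fixed point `b` contributes `c + 1`, an insertion keeps `c` and flips the sign).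
[folklore] -/
theorem sum_sign_mul_numCycles_step (b : β) :
    (∑ π : Perm β, ((Perm.sign π : ℤ) : R) * (π.numCycles : R)) =
      (2 - (Fintype.card β : R)) *
          ∑ τ : Perm {y // y ≠ b}, ((Perm.sign τ : ℤ) : R) * (τ.numCycles : R) +
        ∑ τ : Perm {y // y ≠ b}, ((Perm.sign τ : ℤ) : R) := by
  rw [sum_perm_eq_sum_sum_ite b]
  have hterm : ∀ a : β,
      (∑ π : Perm β, if π b = a then ((Perm.sign π : ℤ) : R) * (π.numCycles : R) else 0) =
      (if a = b then (1 : R) else -1) *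
          ∑ τ : Perm {y // y ≠ b}, ((Perm.sign τ : ℤ) : R) * (τ.numCycles : R) +
        (if a = b then (1 : R) else 0) * ∑ τ : Perm {y // y ≠ b}, ((Perm.sign τ : ℤ) : R) := by
    intro a
    by_cases hab : a = b
    · rw [hab, sum_perm_apply_eq_self, if_pos rfl, if_pos rfl, one_mul, one_mul,
        ← Finset.sum_add_distrib]
      exact Finset.sum_congr rfl fun τ _ => by
        rw [sign_ofSubtype_int, numCycles_ofSubtype_ne]; push_cast; ring
    · rw [sum_perm_apply_eq_swap_mul a b, if_neg hab, if_neg hab, zero_mul, add_zero,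
        Finset.mul_sum]
      exact Finset.sum_congr rfl fun τ _ => by
        rw [sign_swap_mul_ofSubtype hab, numCycles_swap_mul_ofSubtype hab]; push_cast; ring
  simp_rw [hterm]
  rw [Finset.sum_add_distrib, ← Finset.sum_mul, ← Finset.sum_mul, Finset.sum_ite,
    Finset.sum_const, Finset.sum_const, Finset.filter_eq' Finset.univ b,
    if_pos (Finset.mem_univ b), Finset.card_singleton, Finset.filter_ne' Finset.univ b,
    Finset.card_erase_of_mem (Finset.mem_univ b), Finset.card_univ, Finset.sum_ite_eq',
    if_pos (Finset.mem_univ b)]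
  have h1 : 1 ≤ Fintype.card β := Fintype.card_pos_iff.mpr ⟨b⟩
  simp only [nsmul_eq_mul, Nat.cast_sub h1, Nat.cast_one, one_smul, smul_neg]
  ring

/-- **`Σ_π sgn π`** over all permutations of a finite type: `1` if the type has at most one
element, `0` otherwise. [folklore] -/
theorem sum_sign_eq : ∀ (m : ℕ) (γ : Type u) [Fintype γ] [DecidableEq γ],
    Fintype.card γ = m → (∑ π : Perm γ, ((Perm.sign π : ℤ) : R)) = if m ≤ 1 then 1 else 0 := by
  intro m
  induction m with
  | zero =>
    intro γ _ _ hγ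
    haveI : IsEmpty γ := Fintype.card_eq_zero_iff.mp hγ
    have h1 : ∀ π : Perm γ, π = 1 := fun π => Equiv.ext fun x => isEmptyElim x
    rw [if_pos (Nat.zero_le 1), Fintype.sum_eq_single (1 : Perm γ) fun π hπ => absurd (h1 π) hπ,
      Perm.sign_one, Units.val_one, Int.cast_one]
  | succ m ih =>
    intro γ _ _ hγ
    obtain ⟨b⟩ : Nonempty γ := Fintype.card_pos_iff.mp (by omega)
    rw [sum_sign_step b, ih {y // y ≠ b} (by rw [card_subtype_ne, hγ]; rfl), hγ]
    by_cases hm : m ≤ 1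
    · rw [if_pos hm]
      interval_cases m <;> norm_num
    · rw [if_neg hm, if_neg (by omega), mul_zero]

/-- **`Σ_π sgn π · c(π)`** over all permutations of a type with `m` elements: `m` for `m ≤ 1` and
`(-1)^m (m-2)!` for `m ≥ 2` — the derivative at `u = 1` of the falling factorial
`Σ_π sgn π u^{c(π)} = u(u-1)⋯(u-m+1)` (signed Stirling numbers of the first kind;
Stanley, EC1, Prop. 1.3.7). [folklore] -/
theorem sum_sign_mul_numCycles_eq : ∀ (m : ℕ) (γ : Type u) [Fintype γ] [DecidableEq γ],
    Fintype.card γ = m → (∑ π : Perm γ, ((Perm.sign π : ℤ) : R) * (π.numCycles : R)) =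
      if m ≤ 1 then (m : R) else (-1) ^ m * ((m - 2).factorial : R) := by
  intro m
  induction m with
  | zero =>
    intro γ _ _ hγ
    haveI : IsEmpty γ := Fintype.card_eq_zero_iff.mp hγ
    have h1 : ∀ π : Perm γ, π = 1 := fun π => Equiv.ext fun x => isEmptyElim x
    rw [if_pos (Nat.zero_le 1), Fintype.sum_eq_single (1 : Perm γ) fun π hπ => absurd (h1 π) hπ,
      Equiv.Perm.numCycles_one, hγ]
    simp
  | succ m ih =>
    intro γ _ _ hγ
    obtain ⟨b⟩ : Nonempty γ := Fintype.card_pos_iff.mp (by omega)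
    have hc : Fintype.card {y // y ≠ b} = m := by rw [card_subtype_ne, hγ]; rfl
    rw [sum_sign_mul_numCycles_step b, ih {y // y ≠ b} hc, sum_sign_eq m {y // y ≠ b} hc, hγ]
    by_cases hm : m ≤ 1
    · rw [if_pos hm]
      interval_cases m <;> norm_num
    · rw [if_neg hm, if_neg (by omega), add_zero]
      obtain ⟨j, rfl⟩ : ∃ j, m = j + 2 := ⟨m - 2, by omega⟩
      simp only [show j + 2 - 2 = j from rfl, show j + 2 + 1 - 2 = j + 1 from rfl,
        Nat.factorial_succ, pow_succ]
      push_cast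
      ring

/-! ### One prescribed value -/

/-- `Σ_{π b = b} sgn π = Σ_τ sgn τ` and `Σ_{π b = a} sgn π = -Σ_τ sgn τ` (`a ≠ b`), the right-hand
sums over permutations of `{y // y ≠ b}`. [folklore] -/
theorem sum_sign_apply_eq (a b : β) :
    (∑ π : Perm β, if π b = a then ((Perm.sign π : ℤ) : R) else 0) =
      (if a = b then (1 : R) else -1) * ∑ τ : Perm {y // y ≠ b}, ((Perm.sign τ : ℤ) : R) := by
  by_cases hab : a = b
  · rw [hab, sum_perm_apply_eq_self, if_pos rfl, one_mul]
    exact Finset.sum_congr rfl fun τ _ => by rw [sign_ofSubtype_int]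
  · rw [sum_perm_apply_eq_swap_mul a b, if_neg hab, Finset.mul_sum]
    exact Finset.sum_congr rfl fun τ _ => by rw [sign_swap_mul_ofSubtype hab]; push_cast; ring

/-- `Σ_{π b = b} sgn π · c(π) = Σ_τ sgn τ · c(τ) + Σ_τ sgn τ` and, for `a ≠ b`,
`Σ_{π b = a} sgn π · c(π) = -Σ_τ sgn τ · c(τ)`, sums over permutations of `{y // y ≠ b}`.
[folklore] -/
theorem sum_sign_mul_numCycles_apply_eq (a b : β) :
    (∑ π : Perm β, if π b = a then ((Perm.sign π : ℤ) : R) * (π.numCycles : R) else 0) =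
      (if a = b then (1 : R) else -1) *
          ∑ τ : Perm {y // y ≠ b}, ((Perm.sign τ : ℤ) : R) * (τ.numCycles : R) +
        (if a = b then (1 : R) else 0) * ∑ τ : Perm {y // y ≠ b}, ((Perm.sign τ : ℤ) : R) := by
  by_cases hab : a = b
  · rw [hab, sum_perm_apply_eq_self, if_pos rfl, if_pos rfl, one_mul, one_mul,
      ← Finset.sum_add_distrib]
    exact Finset.sum_congr rfl fun τ _ => by
      rw [sign_ofSubtype_int, numCycles_ofSubtype_ne]; push_cast; ring
  · rw [sum_perm_apply_eq_swap_mul a b, if_neg hab, if_neg hab, zero_mul, add_zero, Finset.mul_sum]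
    exact Finset.sum_congr rfl fun τ _ => by
      rw [sign_swap_mul_ofSubtype hab, numCycles_swap_mul_ofSubtype hab]; push_cast; ring

end Summit.ValiantsHypothesis.ValiantsHypothesis.Theorems.FermionicJet.NumCyclesSums
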